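import Literature.Computability.Complexity.StackRadixSort
import Literature.Computability.Complexity.StackWords
import Literature.Computability.Complexity.YatesTables
import Literature.Computability.Complexity.Williams2014AccSat
import HarnessLib

/-!
# The evaluation machine of Williams' Lemma 4.2, I: bank, input format, parsing, mask words

Literature / circuit complexity. Williams' **evaluation lemma** (R. Williams, *Nonuniform ACC
circuit lower bounds*, J. ACM 61 (2014), Lemma 4.2: the truth table of a `SYM⁺` circuit with `n`
inputs and `s` terms in `(2ⁿ + poly(s)) · poly(n)` time; Proof 2 = Yates' algorithm, App. C =
its multitape implementation) is the named fact `Williams2014_lemma_4_2`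
(`Williams2014AccSat.lean`); its hypothesis-free form is the hypothesis `hE` of the assembly of
Thm. 4.1 (`Williams2014AccSatAssembly.lean`). This series of files CONSTRUCTS the machine `E`
as a structured stack program (`StackPrograms.lean`) and proves its specification phase by
phase; the mathematics of the tables is `YatesZeta.lean` / `YatesTables.lean`, the generic
routines are `StackStreams.lean`, `StackWords.lean`, `StackRadixSort.lean`. This first file:

* the input format: `encodingListNatBool_encode_eq_encList` (the library code of a list of
  naturals is the item list of the unary length and the binary numerals, so `Com.readItem`
  reads it), `encodeSymPlus_items`, `bodyItems_eq` (`termItems`, `tableItems`);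
* the register bank `YReg = RReg ⊕ YOwn` (the radix sorter's ten registers on the left, reused
  as work registers between sorts; twenty own registers `YOwn`, file `YRF` with `simp` lemmas),
  the file `est ρ σ`, and the embedding of left routines (`runs_inl`, `runs_sort`: the sorter
  runs inside the machine by `Exec.map` / `graft_inl`);
* small routines: `countBits` (unary length of a word), `walkBits` (move `i` bits aside),
  `setTop`, `length_encodeNat_le_self` (`|bin k| ≤ k`, for cost bounds in terms of values);
* **Phase 0** `parseProg` / `runs_parseProg`: drop the length item, `N := 1ⁿ`, `Bw := 1ᵇ`
  (`b = |bin s|`, the field width, `s < 2ᵇ`), `Sc := 1ˢ`, cost `parseCost`;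
* **Phase 1** `masksProg` / `runs_masksProg` (`idxBody`, `termBody`, `runs_idxLoop`): for every
  term, read its cardinality and its variables, set the corresponding bits of the all-zero word
  (`foldl_set_eq_maskWord`: the result is `maskWord t`, bit `i` = `[i ∈ t]`), tag it with a
  leading `0` and emit it onto `M`; after the phase `M = outRev (terms.map (0 :: maskWord ·))`
  and the input holds the table items only; cost `s · (termBound n + 2) + 1`, `termBound n =
  O(n³)`.

Specifications are stated over arbitrary files with hypotheses on the registers a phase uses
(frame style), the final file as a structure update; costs are exact or uniform polynomial
bounds in `n`, `s` and the code length.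

## References

* R. Williams, *Nonuniform ACC circuit lower bounds*, J. ACM 61(1) (2014) 2:1–2:32, Lemma 4.2
  with Proof 2 and App. C [Williams2014].
* S. Arora, B. Barak, *Computational Complexity: A Modern Approach*, CUP 2009, §0.1 (codes of
  tuples), §1.3 (machine constructions) [AroraBarak2009].
* T. Nipkow, G. Klein, *Concrete Semantics with Isabelle/HOL*, Springer 2014, §7.2 — the
  verification style of `StackPrograms.lean`.
-/

namespace Literature.Computability.Complexity

open SProg Com _root_.Computability

/-! ### The input code is a flat list of items -/

/-- The library's list-of-naturals code is the item list of the unary length followed by the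
binary numerals: `encode l = encList (1^{|l|} :: l.map encodeNat)` — so a machine reads it
item by item with `Com.readItem`. [folklore] -/
theorem encodingListNatBool_encode_eq_encList (l : List ℕ) :
    encodingListNatBool.encode l = encList (unaryEncodeNat l.length :: l.map encodeNat) := by
  change boolPair (unaryEncodeNat l.length) (l.foldr (fun a acc => boolPair (encodeNat a) acc) []) = _
  rw [encList_cons]
  congr 1
  induction l with
  | nil => rfl
  | cons a l ih => rw [List.foldr_cons, List.map_cons, encList_cons, ih]

/-- Hence the code of a `SYM⁺` circuit handed to the evaluation machine is the item list of
`symPlusCodeList` behind its unary length. [folklore] -/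
theorem encodeSymPlus_eq_encList {n : ℕ} (S : SymPlus n) :
    encodeSymPlus S = encList (unaryEncodeNat (symPlusCodeList S).length ::
      (symPlusCodeList S).map encodeNat) :=
  encodingListNatBool_encode_eq_encList _

/-- The own registers of the evaluation machine (see the module docstring for their roles). [folklore] -/
inductive YOwn
  | inp | N | N2 | Bw | Sc | M | Ek | blk | blk2 | acc | cy | X | Y | out | B2 | C | Cc | Ic | Wd | P
  deriving DecidableEq, Fintype, Repr

/-- The own register file of the evaluation machine by name. [folklore] -/
structure YRF where
  /-- the input code -/ (inp : List Bool)
  /-- unary `n` -/ (N : List Bool)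
  /-- scratch for unary counters -/ (N2 : List Bool)
  /-- unary field width `b` -/ (Bw : List Bool)
  /-- unary number of terms `s` -/ (Sc : List Bool)
  /-- mask words (reversed code) -/ (M : List Bool)
  /-- kept enumeration of the cube -/ (Ek : List Bool)
  /-- unary block length `2ʲ` -/ (blk : List Bool)
  /-- parking for `blk` -/ (blk2 : List Bool)
  /-- the counter word -/ (acc : List Bool)
  /-- carry flag -/ (cy : List Bool)
  /-- the current value bit of the symmetric gate -/ (X : List Bool)
  /-- output bits (reversed) -/ (Y : List Bool)
  /-- the output register -/ (out : List Bool)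
  /-- forward buffer of a lower half-block -/ (B2 : List Bool)
  /-- second operand word -/ (C : List Bool)
  /-- unary cardinality of the current term -/ (Cc : List Bool)
  /-- unary index of the current variable -/ (Ic : List Bool)
  /-- the mask word under construction -/ (Wd : List Bool)
  /-- prefix holder of the bit walk -/ (P : List Bool)

namespace YRF

/-- The own register file as a function. [folklore] -/
def regs (σ : YRF) : Regs YOwn
  | .inp => σ.inp | .N => σ.N | .N2 => σ.N2 | .Bw => σ.Bw | .Sc => σ.Sc | .M => σ.M | .Ek => σ.Ek | .blk => σ.blk | .blk2 => σ.blk2 | .acc => σ.acc | .cy => σ.cy | .X => σ.X | .Y => σ.Y | .out => σ.out | .B2 => σ.B2 | .C => σ.C | .Cc => σ.Cc | .Ic => σ.Ic | .Wd => σ.Wd | .P => σ.P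

/-- The all-empty own file. [folklore] -/
@[simps] def empty : YRF := ⟨[], [], [], [], [], [], [], [], [], [], [], [], [], [], [], [], [], [], [], []⟩

section Simp

variable (σ : YRF) (v : List Bool)

/-- reading `inp` [folklore] -/ @[simp] theorem regs_inp : regs σ .inp = σ.inp := rfl
/-- reading `N` [folklore] -/ @[simp] theorem regs_N : regs σ .N = σ.N := rfl
/-- reading `N2` [folklore] -/ @[simp] theorem regs_N2 : regs σ .N2 = σ.N2 := rfl
/-- reading `Bw` [folklore] -/ @[simp] theorem regs_Bw : regs σ .Bw = σ.Bw := rfl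
/-- reading `Sc` [folklore] -/ @[simp] theorem regs_Sc : regs σ .Sc = σ.Sc := rfl
/-- reading `M` [folklore] -/ @[simp] theorem regs_M : regs σ .M = σ.M := rfl
/-- reading `Ek` [folklore] -/ @[simp] theorem regs_Ek : regs σ .Ek = σ.Ek := rfl
/-- reading `blk` [folklore] -/ @[simp] theorem regs_blk : regs σ .blk = σ.blk := rfl
/-- reading `blk2` [folklore] -/ @[simp] theorem regs_blk2 : regs σ .blk2 = σ.blk2 := rfl
/-- reading `acc` [folklore] -/ @[simp] theorem regs_acc : regs σ .acc = σ.acc := rfl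
/-- reading `cy` [folklore] -/ @[simp] theorem regs_cy : regs σ .cy = σ.cy := rfl
/-- reading `X` [folklore] -/ @[simp] theorem regs_X : regs σ .X = σ.X := rfl
/-- reading `Y` [folklore] -/ @[simp] theorem regs_Y : regs σ .Y = σ.Y := rfl
/-- reading `out` [folklore] -/ @[simp] theorem regs_out : regs σ .out = σ.out := rfl
/-- reading `B2` [folklore] -/ @[simp] theorem regs_B2 : regs σ .B2 = σ.B2 := rfl
/-- reading `C` [folklore] -/ @[simp] theorem regs_C : regs σ .C = σ.C := rfl
/-- reading `Cc` [folklore] -/ @[simp] theorem regs_Cc : regs σ .Cc = σ.Cc := rfl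
/-- reading `Ic` [folklore] -/ @[simp] theorem regs_Ic : regs σ .Ic = σ.Ic := rfl
/-- reading `Wd` [folklore] -/ @[simp] theorem regs_Wd : regs σ .Wd = σ.Wd := rfl
/-- reading `P` [folklore] -/ @[simp] theorem regs_P : regs σ .P = σ.P := rfl

/-- updating `inp` [folklore] -/
@[simp] theorem update_inp : Function.update (regs σ) .inp v = regs { σ with inp := v } := by
  funext i; cases i <;> rfl
/-- updating `N` [folklore] -/
@[simp] theorem update_N : Function.update (regs σ) .N v = regs { σ with N := v } := by
  funext i; cases i <;> rfl
/-- updating `N2` [folklore] -/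
@[simp] theorem update_N2 : Function.update (regs σ) .N2 v = regs { σ with N2 := v } := by
  funext i; cases i <;> rfl
/-- updating `Bw` [folklore] -/
@[simp] theorem update_Bw : Function.update (regs σ) .Bw v = regs { σ with Bw := v } := by
  funext i; cases i <;> rfl
/-- updating `Sc` [folklore] -/
@[simp] theorem update_Sc : Function.update (regs σ) .Sc v = regs { σ with Sc := v } := by
  funext i; cases i <;> rfl
/-- updating `M` [folklore] -/
@[simp] theorem update_M : Function.update (regs σ) .M v = regs { σ with M := v } := by
  funext i; cases i <;> rfl
/-- updating `Ek` [folklore] -/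
@[simp] theorem update_Ek : Function.update (regs σ) .Ek v = regs { σ with Ek := v } := by
  funext i; cases i <;> rfl
/-- updating `blk` [folklore] -/
@[simp] theorem update_blk : Function.update (regs σ) .blk v = regs { σ with blk := v } := by
  funext i; cases i <;> rfl
/-- updating `blk2` [folklore] -/
@[simp] theorem update_blk2 : Function.update (regs σ) .blk2 v = regs { σ with blk2 := v } := by
  funext i; cases i <;> rfl
/-- updating `acc` [folklore] -/
@[simp] theorem update_acc : Function.update (regs σ) .acc v = regs { σ with acc := v } := by
  funext i; cases i <;> rfl
/-- updating `cy` [folklore] -/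
@[simp] theorem update_cy : Function.update (regs σ) .cy v = regs { σ with cy := v } := by
  funext i; cases i <;> rfl
/-- updating `X` [folklore] -/
@[simp] theorem update_X : Function.update (regs σ) .X v = regs { σ with X := v } := by
  funext i; cases i <;> rfl
/-- updating `Y` [folklore] -/
@[simp] theorem update_Y : Function.update (regs σ) .Y v = regs { σ with Y := v } := by
  funext i; cases i <;> rfl
/-- updating `out` [folklore] -/
@[simp] theorem update_out : Function.update (regs σ) .out v = regs { σ with out := v } := by
  funext i; cases i <;> rfl
/-- updating `B2` [folklore] -/
@[simp] theorem update_B2 : Function.update (regs σ) .B2 v = regs { σ with B2 := v } := by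
  funext i; cases i <;> rfl
/-- updating `C` [folklore] -/
@[simp] theorem update_C : Function.update (regs σ) .C v = regs { σ with C := v } := by
  funext i; cases i <;> rfl
/-- updating `Cc` [folklore] -/
@[simp] theorem update_Cc : Function.update (regs σ) .Cc v = regs { σ with Cc := v } := by
  funext i; cases i <;> rfl
/-- updating `Ic` [folklore] -/
@[simp] theorem update_Ic : Function.update (regs σ) .Ic v = regs { σ with Ic := v } := by
  funext i; cases i <;> rfl
/-- updating `Wd` [folklore] -/
@[simp] theorem update_Wd : Function.update (regs σ) .Wd v = regs { σ with Wd := v } := by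
  funext i; cases i <;> rfl
/-- updating `P` [folklore] -/
@[simp] theorem update_P : Function.update (regs σ) .P v = regs { σ with P := v } := by
  funext i; cases i <;> rfl

/-- The empty file is empty. [folklore] -/
@[simp] theorem regs_empty (r : YOwn) : regs empty r = [] := by cases r <;> rfl

end Simp

end YRF

/-! ### The register type: the radix sorter's bank on the left, the own registers on the right -/

/-- The registers of the evaluation machine. [folklore] -/
abbrev YReg := RReg ⊕ YOwn

namespace YatesM

open RRF YRF

/-- The file of the machine from the two named files. [folklore] -/
abbrev est (ρ : RRF) (σ : YRF) : Regs YReg := Sum.elim ρ.regs σ.regs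

/-- Updating a left register. [folklore] -/
@[simp] theorem update_est_inl (ρ : RRF) (σ : YRF) (r : RReg) (v : List Bool) :
    Function.update (est ρ σ) (Sum.inl r) v = Sum.elim (Function.update ρ.regs r v) σ.regs :=
  Sum.update_elim_inl

/-- Updating a right register. [folklore] -/
@[simp] theorem update_est_inr (ρ : RRF) (σ : YRF) (r : YOwn) (v : List Bool) :
    Function.update (est ρ σ) (Sum.inr r) v = Sum.elim ρ.regs (Function.update σ.regs r v) :=
  Sum.update_elim_inr

/-- **The radix sorter runs inside the machine** (embedded along `Sum.inl`): its effect on the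
left file, the right file untouched. [folklore] -/
theorem runs_sort (k : ℕ) (l : List (List Bool)) (ρ : RRF) (σ : YRF) (hL : ρ.L = encList l)
    (hA : ρ.A = []) (hz : ρ.z = []) (ho : ρ.o = []) (hw : ρ.w = []) (ht : ρ.t = []) (hU : ρ.U = [])
    (hV : ρ.V = []) (hp : ρ.p = []) (hW : ρ.W = List.replicate k true) :
    Runs (Radix.sortProg.map Sum.inl) (est ρ σ) (est { ρ with
      L := encList (radixIter l k), U := List.replicate k true, W := [] } σ)
      (k * (Radix.passCost k l + 3) + 1) := by
  obtain ⟨t, ht, e⟩ := Radix.runs_sortProg k l ρ hL hA hz ho hw ht hU hV hp hW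
  have h := e.map Sum.inl_injective (est ρ σ) (fun i => rfl)
  rw [graft_inl] at h
  exact ⟨t, ht, h⟩

/-- More generally, any routine of the sorter's bank runs inside the machine. [folklore] -/
theorem runs_inl {c : Com RReg} {ρ ρ' : RRF} {B : ℕ} (h : Runs c ρ.regs ρ'.regs B) (σ : YRF) :
    Runs (c.map Sum.inl) (est ρ σ) (est ρ' σ) B := by
  obtain ⟨t, ht, e⟩ := h
  have h := e.map Sum.inl_injective (est ρ σ) (fun i => rfl)
  rw [graft_inl] at h
  exact ⟨t, ht, h⟩

/-! ### Register names -/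

/-- left: the current word -/ abbrev iA : YReg := Sum.inl RReg.A
/-- left: the list -/ abbrev iL : YReg := Sum.inl RReg.L
/-- left: token register -/ abbrev iw : YReg := Sum.inl RReg.w
/-- left: reader scratch -/ abbrev it : YReg := Sum.inl RReg.t
/-- left: output `0` -/ abbrev iz : YReg := Sum.inl RReg.z
/-- left: output `1` -/ abbrev io : YReg := Sum.inl RReg.o
/-- left: unary counter -/ abbrev iU : YReg := Sum.inl RReg.U
/-- left: parking -/ abbrev iV : YReg := Sum.inl RReg.V
/-- left: prefix holder -/ abbrev ip : YReg := Sum.inl RReg.p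
/-- left: pass counter -/ abbrev iW : YReg := Sum.inl RReg.W
/-- right: input -/ abbrev oInp : YReg := Sum.inr YOwn.inp
/-- right: unary `n` -/ abbrev oN : YReg := Sum.inr YOwn.N
/-- right: counter scratch -/ abbrev oN2 : YReg := Sum.inr YOwn.N2
/-- right: unary width -/ abbrev oBw : YReg := Sum.inr YOwn.Bw
/-- right: unary `s` -/ abbrev oSc : YReg := Sum.inr YOwn.Sc
/-- right: masks -/ abbrev oM : YReg := Sum.inr YOwn.M
/-- right: kept enumeration -/ abbrev oEk : YReg := Sum.inr YOwn.Ek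
/-- right: block length -/ abbrev oBlk : YReg := Sum.inr YOwn.blk
/-- right: block parking -/ abbrev oBlk2 : YReg := Sum.inr YOwn.blk2
/-- right: counter word -/ abbrev oAcc : YReg := Sum.inr YOwn.acc
/-- right: carry -/ abbrev oCy : YReg := Sum.inr YOwn.cy
/-- right: value bit -/ abbrev oX : YReg := Sum.inr YOwn.X
/-- right: output bits -/ abbrev oY : YReg := Sum.inr YOwn.Y
/-- right: output -/ abbrev oOut : YReg := Sum.inr YOwn.out
/-- right: forward buffer -/ abbrev oB2 : YReg := Sum.inr YOwn.B2
/-- right: second operand -/ abbrev oC : YReg := Sum.inr YOwn.C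
/-- right: unary cardinality -/ abbrev oCc : YReg := Sum.inr YOwn.Cc
/-- right: unary index -/ abbrev oIc : YReg := Sum.inr YOwn.Ic
/-- right: mask word -/ abbrev oWd : YReg := Sum.inr YOwn.Wd
/-- right: walk prefix -/ abbrev oP : YReg := Sum.inr YOwn.P

/-- The all-empty left file. [folklore] -/
@[simps] def lclean : RRF := ⟨[], [], [], [], [], [], [], [], [], []⟩

/-- The empty left file is empty. [folklore] -/
@[simp] theorem regs_lclean (r : RReg) : lclean.regs r = [] := by cases r <;> rfl

/-! ### Counting the bits of a word in unary -/

/-- `countBits A B P`: one token on `B` per bit of `A` (kept: its bits go to `P` and back).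
[folklore] -/
def countBits (A B P : YReg) : Com YReg :=
  loop A (push B true ;; push P true) (push B true ;; push P false) ;; pour P A

/-- Effect of `countBits`: `B := 1^{|A|} ++ B`, `A` restored, `7 |A| + 2` steps. [folklore] -/
theorem runs_countBits {A B P : YReg} (hAB : A ≠ B) (hAP : A ≠ P) (hBP : B ≠ P) (R : Regs YReg)
    (hP : R P = []) :
    Runs (countBits A B P) R (Function.update R B (List.replicate (R A).length true ++ R B))
      (7 * (R A).length + 2) := by
  have hloop : ∀ (u : List Bool) (S : Regs YReg), S A = u →
      Runs (loop A (push B true ;; push P true) (push B true ;; push P false)) S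
        (Function.update (Function.update (Function.update S A []) B
          (List.replicate u.length true ++ S B)) P (u.reverse ++ S P)) (4 * u.length + 1) := by
    intro u
    induction u with
    | nil =>
      intro S hS
      refine (Runs.loop_nil _ _ hS).of_eq ?_ (by simp)
      ext i : 1; simp only [Function.update_apply]; split_ifs <;> simp_all
    | cons b u ih =>
      intro S hS
      have hb : Runs (bif b then (push B true ;; push P true) else (push B true ;; push P false))
          (Function.update S A u)
          (Function.update (Function.update (Function.update S A u) B (true :: S B)) P (b :: S P)) 2 := by
        cases b
        · refine ((Runs.push B true _).seq (Runs.push P false _)).of_eq ?_ (by rfl)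
          ext i : 1; simp only [Function.update_apply]; split_ifs <;> simp_all
        · refine ((Runs.push B true _).seq (Runs.push P true _)).of_eq ?_ (by rfl)
          ext i : 1; simp only [Function.update_apply]; split_ifs <;> simp_all
      have ih' := ih (Function.update (Function.update (Function.update S A u) B (true :: S B)) P
        (b :: S P)) (by simp only [Function.update_apply]; split_ifs <;> simp_all)
      have hfin : Function.update (Function.update (Function.update (Function.update (Function.update
          (Function.update S A u) B (true :: S B)) P (b :: S P)) A []) B (List.replicate u.length true ++
          Function.update (Function.update (Function.update S A u) B (true :: S B)) P (b :: S P) B)) P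
          (u.reverse ++ Function.update (Function.update (Function.update S A u) B (true :: S B)) P
          (b :: S P) P) = Function.update (Function.update (Function.update S A []) B
          (List.replicate (b :: u).length true ++ S B)) P ((b :: u).reverse ++ S P) := by
        ext i : 1; simp only [Function.update_apply]
        split_ifs <;> simp_all [List.replicate_succ']
      rw [hfin] at ih'
      cases b
      · exact (Runs.loop_false hS hb ih').of_eq rfl (by simp; omega)
      · exact (Runs.loop_true hS hb ih').of_eq rfl (by simp; omega)
  have h1 := hloop (R A) R rfl
  have h2 := runs_pour (Ne.symm hAP) (Function.update (Function.update (Function.update R A []) B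
    (List.replicate (R A).length true ++ R B)) P ((R A).reverse ++ R P))
  have hPl : (Function.update (Function.update (Function.update R A []) B
      (List.replicate (R A).length true ++ R B)) P ((R A).reverse ++ R P) P).length = (R A).length := by
    simp [hP]
  refine (h1.seq h2).of_eq ?_ (by omega)
  ext i : 1; simp only [Function.update_apply]; split_ifs <;> simp_all

/-- The unary numeral of `k` has length `k`. [folklore] -/
@[simp] theorem length_unaryEncodeNat : ∀ k : ℕ, (unaryEncodeNat k).length = k
  | 0 => rfl
  | k + 1 => by rw [unaryEncodeNat, List.length_cons, length_unaryEncodeNat k]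

/-! ### Phase 0: parsing the header -/

/-- `parseProg`: drop the length item; read `n` and convert it to unary on `N`; read `s`, count
its bits in unary on `Bw` (the field width `b = |bin s|`, `s < 2ᵇ`) and convert it to unary on
`Sc`. [folklore] -/
def parseProg : Com YReg :=
  skipItem oInp iw it ;;
  (readItem oInp iA iw ;; binToUnary iA oN oN2) ;;
  (readItem oInp iA iw ;; countBits iA oBw oP ;; binToUnary iA oSc oN2)

/-- The items of the code of `S` behind the header `n, s`: the terms, then the value table.
[folklore] -/
def bodyItems {n : ℕ} (S : SymPlus n) : List (List Bool) :=
  ((S.terms.flatMap fun t : Finset (Fin n) => t.card :: (t.sort (· ≤ ·)).map Fin.val) ++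
    (List.range (S.size + 1)).map fun v => if S.sym v then 1 else 0).map encodeNat

/-- The input as read by the machine: length item, `n`, `s`, then `bodyItems`. [folklore] -/
theorem encodeSymPlus_items {n : ℕ} (S : SymPlus n) :
    encodeSymPlus S = encList (unaryEncodeNat (symPlusCodeList S).length :: encodeNat n ::
      encodeNat S.size :: bodyItems S) := by
  rw [encodeSymPlus_eq_encList]
  congr 2

/-- The cost of the parsing phase. [folklore] -/
def parseCost (len n s : ℕ) : ℕ :=
  10 * len + 9 + (8 * (encodeNat n).length + 8 + ((encodeNat n).length * (7 * n + 5) + 1)) +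
    (8 * (encodeNat s).length + 8 + (7 * (encodeNat s).length + 2) +
      ((encodeNat s).length * (7 * s + 5) + 1))

/-- **Effect of the parsing phase.** From a file with the input code on `inp` and the registers
it uses empty, `parseProg` leaves the body items on `inp`, `N = 1ⁿ`, `Bw = 1ᵇ` with
`b = |bin s|`, `Sc = 1ˢ`, the rest unchanged, within `parseCost ℓ n s` steps (`ℓ` the number of
naturals in the code). [folklore] -/
theorem runs_parseProg {n : ℕ} (S : SymPlus n) (ρ : RRF) (σ : YRF) (hA : ρ.A = []) (hw : ρ.w = [])
    (ht : ρ.t = []) (hinp : σ.inp = encodeSymPlus S) (hN : σ.N = []) (hN2 : σ.N2 = [])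
    (hBw : σ.Bw = []) (hSc : σ.Sc = []) (hP : σ.P = []) :
    Runs parseProg (est ρ σ)
      (est ρ { σ with
        inp := encList (bodyItems S), N := List.replicate n true,
        Bw := List.replicate (encodeNat S.size).length true, Sc := List.replicate S.size true })
      (parseCost (symPlusCodeList S).length n S.size) := by
  rw [encodeSymPlus_items] at hinp
  set σ₁ : YRF := { σ with inp := encList (encodeNat n :: encodeNat S.size :: bodyItems S) } with hσ₁
  -- drop the length item
  have h1 : Runs (skipItem oInp iw it) (est ρ σ) (est ρ σ₁) (10 * (symPlusCodeList S).length + 9) := by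
    have h := runs_skipItem (L := oInp) (w := iw) (t := it) (by decide) (by decide) (by decide)
      (unaryEncodeNat (symPlusCodeList S).length) (encList (encodeNat n :: encodeNat S.size :: bodyItems S))
      (est ρ σ) (by simp [hinp, encList_cons_eq_dbl]) (by simp [hw]) (by simp [ht])
    refine h.of_eq ?_ (by simp)
    simp only [hσ₁]; simp
  -- read `n`, convert to unary
  set σ₂ : YRF := { σ with inp := encList (encodeNat S.size :: bodyItems S) } with hσ₂
  set ρ₂ : RRF := { ρ with A := (encodeNat n).reverse } with hρ₂
  have h2 : Runs (readItem oInp iA iw) (est ρ σ₁) (est ρ₂ σ₂) (8 * (encodeNat n).length + 8) := by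
    have h := runs_readItem (L := oInp) (A := iA) (w := iw) (by decide) (by decide) (by decide)
      (encodeNat n) (encList (encodeNat S.size :: bodyItems S)) (est ρ σ₁)
      (by simp [hσ₁, encList_cons_eq_dbl]) (by simp [hw])
    refine h.of_eq ?_ le_rfl
    simp only [hσ₁, hσ₂, hρ₂]; simp [hA]
  set σ₃ : YRF := { σ₂ with N := List.replicate n true } with hσ₃
  have h3 : Runs (binToUnary iA oN oN2) (est ρ₂ σ₂) (est ρ σ₃)
      ((encodeNat n).length * (7 * n + 5) + 1) := by
    have h := runs_binToUnary (A := iA) (N := oN) (N2 := oN2) (by decide) (by decide) (by decide)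
      ((encodeNat n).reverse) 0 (est ρ₂ σ₂) (by simp [hρ₂]) (by simp [hσ₂, hN]) (by simp [hσ₂, hN2])
    simp only [List.length_reverse, zero_mul, zero_add, msbVal_reverse_encodeNat] at h
    refine h.of_eq ?_ le_rfl
    simp only [hσ₃, hσ₂, hρ₂]; simp [← hA]
  -- read `s`, count its bits, convert to unary
  set σ₄ : YRF := { σ₃ with inp := encList (bodyItems S) } with hσ₄
  set ρ₄ : RRF := { ρ with A := (encodeNat S.size).reverse } with hρ₄
  have h4 : Runs (readItem oInp iA iw) (est ρ σ₃) (est ρ₄ σ₄) (8 * (encodeNat S.size).length + 8) := by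
    have h := runs_readItem (L := oInp) (A := iA) (w := iw) (by decide) (by decide) (by decide)
      (encodeNat S.size) (encList (bodyItems S)) (est ρ σ₃)
      (by simp [hσ₃, hσ₂, encList_cons_eq_dbl]) (by simp [hw])
    refine h.of_eq ?_ le_rfl
    simp only [hσ₄, hσ₃, hσ₂, hρ₄]; simp [hA]
  set σ₅ : YRF := { σ₄ with Bw := List.replicate (encodeNat S.size).length true } with hσ₅
  have h5 : Runs (countBits iA oBw oP) (est ρ₄ σ₄) (est ρ₄ σ₅) (7 * (encodeNat S.size).length + 2) := by
    have h := runs_countBits (A := iA) (B := oBw) (P := oP) (by decide) (by decide) (by decide)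
      (est ρ₄ σ₄) (by simp [hσ₄, hσ₃, hσ₂, hP])
    simp only [Sum.elim_inl, RRF.regs_A, hρ₄, List.length_reverse] at h
    refine h.of_eq ?_ le_rfl
    simp only [hσ₅, hσ₄, hσ₃, hσ₂, hρ₄]; simp [hBw]
  set σ₆ : YRF := { σ₅ with Sc := List.replicate S.size true } with hσ₆
  have h6 : Runs (binToUnary iA oSc oN2) (est ρ₄ σ₅) (est ρ σ₆)
      ((encodeNat S.size).length * (7 * S.size + 5) + 1) := by
    have h := runs_binToUnary (A := iA) (N := oSc) (N2 := oN2) (by decide) (by decide) (by decide)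
      ((encodeNat S.size).reverse) 0 (est ρ₄ σ₅) (by simp [hρ₄]) (by simp [hσ₅, hσ₄, hσ₃, hσ₂, hSc])
      (by simp [hσ₅, hσ₄, hσ₃, hσ₂, hN2])
    simp only [List.length_reverse, zero_mul, zero_add, msbVal_reverse_encodeNat] at h
    refine h.of_eq ?_ le_rfl
    simp only [hσ₆, hσ₅, hσ₄, hσ₃, hσ₂, hρ₄]; simp [← hA]
  have H := h1.seq ((h2.seq h3).seq (h4.seq (h5.seq h6)))
  refine H.of_eq ?_ ?_
  · simp only [hσ₆, hσ₅, hσ₄, hσ₃, hσ₂]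
  · unfold parseCost; omega



/-! ### Phase 1: the mask words of the terms -/

/-- The mask word of a term: bit `i` says whether the variable `i` occurs. [folklore] -/
def maskWord {n : ℕ} (t : Finset (Fin n)) : List Bool := List.ofFn fun i : Fin n => decide (i ∈ t)

/-- Setting the bits at the listed positions of the all-zero word gives the indicator word of the
list. [folklore] -/
theorem foldl_set_replicate (n : ℕ) (L : List ℕ) :
    L.foldl (fun w i => w.set i true) (List.replicate n false) =
      List.ofFn fun i : Fin n => decide ((i : ℕ) ∈ L) := by
  suffices H : ∀ (L : List ℕ) (w : List Bool), w.length = n →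
      L.foldl (fun w i => w.set i true) w = List.ofFn fun i : Fin n => (w.getD i false || decide ((i : ℕ) ∈ L)) by
    rw [H L _ (by simp)]; simp
  intro L
  induction L with
  | nil =>
    intro w hw
    subst hw
    rw [List.foldl_nil]
    refine List.ext_getElem (by simp) fun i h₁ h₂ => ?_
    simp only [List.getElem_ofFn, List.not_mem_nil, decide_false, Bool.or_false]
    rw [List.getD_eq_getElem?_getD, List.getElem?_eq_getElem h₁, Option.getD_some]
  | cons j L ih =>
    intro w hw
    rw [List.foldl_cons, ih _ (by simp [hw])]
    congr 1
    funext i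
    rw [List.getD_eq_getElem?_getD, List.getD_eq_getElem?_getD, List.getElem?_set]
    by_cases hji : j = i
    · subst hji; simp [hw]
    · simp [hji, List.mem_cons, eq_comm]

/-- Hence the walk of the machine over the sorted variables of a term produces its mask word.
[folklore] -/
theorem foldl_set_eq_maskWord {n : ℕ} (t : Finset (Fin n)) :
    ((t.sort (· ≤ ·)).map Fin.val).foldl (fun w i => w.set i true) (List.replicate n false) = maskWord t := by
  rw [foldl_set_replicate, maskWord]
  congr 1
  funext i
  simp only [List.mem_map, Finset.mem_sort, decide_eq_decide]
  exact ⟨fun ⟨j, hj, hji⟩ => Fin.ext hji ▸ hj, fun h => ⟨i, h, rfl⟩⟩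

/-- `walkBits Wd P Ic V`: move one bit of `Wd` onto `P` per token of `Ic` (tokens parked on
`V`) — the generic form of the radix sorter's walk. [folklore] -/
def walkBits (Wd P Ic V : YReg) : Com YReg :=
  countLoop Ic (pop Wd (push P true ;; push V true) (push P false ;; push V true) (push V true))

/-- Effect of `walkBits`. [folklore] -/
theorem runs_walkBits {Wd P Ic V : YReg} (h1 : Wd ≠ P) (h2 : Wd ≠ Ic) (h3 : Wd ≠ V) (h4 : P ≠ Ic)
    (h5 : P ≠ V) (h6 : Ic ≠ V) : ∀ (i : ℕ) (R : Regs YReg), R Ic = List.replicate i true →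
      Runs (walkBits Wd P Ic V) R (Function.update (Function.update (Function.update (Function.update R
        Ic []) Wd ((R Wd).drop i)) P (((R Wd).take i).reverse ++ R P)) V (List.replicate i true ++ R V))
        (6 * i + 1)
  | 0, R, hIc => by
    refine (Runs.loop_nil _ _ hIc).of_eq ?_ (by omega)
    ext j : 1; simp only [Function.update_apply]; split_ifs <;> simp_all
  | i + 1, R, hIc => by
    have hk : R Ic = true :: List.replicate i true := by rw [hIc, List.replicate_succ]
    set R₁ : Regs YReg := Function.update (Function.update (Function.update (Function.update R Ic
      (List.replicate i true)) Wd ((R Wd).drop 1)) P (((R Wd).take 1).reverse ++ R P)) V (true :: R V) with hR₁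
    have hb : Runs (pop Wd (push P true ;; push V true) (push P false ;; push V true) (push V true))
        (Function.update R Ic (List.replicate i true)) R₁ 4 := by
      cases hW : R Wd with
      | nil =>
        refine (Runs.pop_nil _ _ (by simp only [Function.update_apply]; split_ifs <;> simp_all)
          (Runs.push V true _)).of_eq ?_ (by omega)
        rw [hR₁]; ext j : 1; simp only [Function.update_apply]; split_ifs <;> simp_all
      | cons b rest =>
        cases b
        · refine (Runs.pop_false _ _ (w := rest) (by simp only [Function.update_apply]; split_ifs <;> simp_all)
            ((Runs.push P false _).seq (Runs.push V true _))).of_eq ?_ (by omega)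
          rw [hR₁]; ext j : 1; simp only [Function.update_apply]; split_ifs <;> simp_all
        · refine (Runs.pop_true _ _ (w := rest) (by simp only [Function.update_apply]; split_ifs <;> simp_all)
            ((Runs.push P true _).seq (Runs.push V true _))).of_eq ?_ (by omega)
          rw [hR₁]; ext j : 1; simp only [Function.update_apply]; split_ifs <;> simp_all
    have ih := runs_walkBits h1 h2 h3 h4 h5 h6 i R₁
      (by rw [hR₁]; simp only [Function.update_apply]; split_ifs <;> simp_all)
    refine (Runs.loop_true hk hb ih).of_eq ?_ (by omega)
    rw [hR₁]
    clear hk hb ih hIc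
    ext j : 1; simp only [Function.update_apply]
    split_ifs <;> simp_all [List.replicate_succ']
    all_goals (cases R Wd <;> simp_all)

/-- Binary numerals are no longer than their value: `|bin k| ≤ k` (a twin of
`SISMachine.encodeNat_length_le_self` of the cryptography corner, not importable here). [folklore] -/
theorem length_encodeNat_le_self (k : ℕ) : (encodeNat k).length ≤ k := by
  have key : ∀ p : PosNum, (encodePosNum p).length ≤ (p : ℕ) := by
    intro p
    induction p with
    | one => simp [encodePosNum]
    | bit0 p ih =>
      simp only [encodePosNum, List.length_cons, PosNum.cast_bit0]
      have : (0 : ℕ) < (p : ℕ) := PosNum.cast_pos p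
      omega
    | bit1 p ih =>
      simp only [encodePosNum, List.length_cons, PosNum.cast_bit1]
      have : (0 : ℕ) < (p : ℕ) := PosNum.cast_pos p
      omega
  change (encodeNum (k : Num)).length ≤ k
  cases hk : (k : Num) with
  | zero => simp [encodeNum]
  | pos p =>
    have : ((p : ℕ) : Num) = Num.pos p := by simp
    have hkp : k = (p : ℕ) := by
      have := congrArg (fun x : Num => (x : ℕ)) hk
      simpa using this
    rw [encodeNum, hkp]; exact key p

/-- `setTop A`: make the top bit of `A` a `1` (push one if `A` is empty). [folklore] -/
def setTop (A : YReg) : Com YReg := pop A (push A true) (push A true) (push A true)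

/-- Effect of `setTop` on a nonempty register. [folklore] -/
theorem runs_setTop_cons (A : YReg) (R : Regs YReg) {b : Bool} {rest : List Bool} (hA : R A = b :: rest) :
    Runs (setTop A) R (Function.update R A (true :: rest)) 3 := by
  cases b
  · exact (Runs.pop_false _ _ hA (Runs.push A true _)).of_eq (by simp) (by rfl)
  · exact (Runs.pop_true _ _ hA (Runs.push A true _)).of_eq (by simp) (by rfl)

/-- The body for one variable of a term: read its index, convert to unary, walk to it, set the
bit, restore. [folklore] -/
def idxBody : Com YReg :=
  readItem oInp iA iw ;; binToUnary iA oIc oN2 ;; walkBits oWd oP oIc iV ;; setTop oWd ;;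
    pour oP oWd ;; clear iV

/-- A uniform bound for the cost of `idxBody` on an index `< n`. [folklore] -/
def idxBound (n : ℕ) : ℕ := 7 * n * n + 24 * n + 15

/-- **Effect of `idxBody`** on the next index `i < |Wd|`: `Wd := Wd.set i true`. [folklore] -/
theorem runs_idxBody {n : ℕ} (i : ℕ) (rest : List Bool) (ρ : RRF) (σ : YRF)
    (hinp : σ.inp = dbl (encodeNat i) ++ false :: true :: rest) (hA : ρ.A = []) (hw : ρ.w = [])
    (hV : ρ.V = []) (hIc : σ.Ic = []) (hN2 : σ.N2 = []) (hP : σ.P = []) (hWd : σ.Wd.length = n)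
    (hi : i < n) :
    Runs idxBody (est ρ σ) (est ρ { σ with inp := rest, Wd := σ.Wd.set i true }) (idxBound n) := by
  set σ₁ : YRF := { σ with inp := rest } with hσ₁
  set ρ₁ : RRF := { ρ with A := (encodeNat i).reverse } with hρ₁
  have h1 : Runs (readItem oInp iA iw) (est ρ σ) (est ρ₁ σ₁) (8 * (encodeNat i).length + 8) := by
    have h := runs_readItem (L := oInp) (A := iA) (w := iw) (by decide) (by decide) (by decide)
      (encodeNat i) rest (est ρ σ) (by simp [hinp]) (by simp [hw])
    refine h.of_eq ?_ le_rfl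
    simp only [hσ₁, hρ₁]; simp [hA]
  set σ₂ : YRF := { σ₁ with Ic := List.replicate i true } with hσ₂
  have h2 : Runs (binToUnary iA oIc oN2) (est ρ₁ σ₁) (est ρ σ₂) ((encodeNat i).length * (7 * i + 5) + 1) := by
    have h := runs_binToUnary (A := iA) (N := oIc) (N2 := oN2) (by decide) (by decide) (by decide)
      ((encodeNat i).reverse) 0 (est ρ₁ σ₁) (by simp [hρ₁]) (by simp [hσ₁, hIc]) (by simp [hσ₁, hN2])
    simp only [List.length_reverse, zero_mul, zero_add, msbVal_reverse_encodeNat] at h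
    refine h.of_eq ?_ le_rfl
    simp only [hσ₂, hσ₁, hρ₁]; simp [← hA]
  set σ₃ : YRF := { σ₂ with Ic := [], Wd := σ.Wd.drop i, P := (σ.Wd.take i).reverse } with hσ₃
  set ρ₃ : RRF := { ρ with V := List.replicate i true } with hρ₃
  have h3 : Runs (walkBits oWd oP oIc iV) (est ρ σ₂) (est ρ₃ σ₃) (6 * i + 1) := by
    have h := runs_walkBits (Wd := oWd) (P := oP) (Ic := oIc) (V := iV) (by decide) (by decide)
      (by decide) (by decide) (by decide) (by decide) i (est ρ σ₂) (by simp [hσ₂])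
    refine h.of_eq ?_ le_rfl
    simp only [hσ₃, hσ₂, hσ₁, hρ₃]; simp [hP, hV]
  obtain ⟨b, rest', hdrop⟩ : ∃ b rest', σ.Wd.drop i = b :: rest' := by
    cases h : σ.Wd.drop i with
    | nil => exfalso; have := congrArg List.length h; simp at this; omega
    | cons b r => exact ⟨b, r, rfl⟩
  have hrest' : rest' = σ.Wd.drop (i + 1) := by
    have := congrArg List.tail hdrop
    simpa using this.symm
  set σ₄ : YRF := { σ₃ with Wd := true :: rest' } with hσ₄
  have h4 : Runs (setTop oWd) (est ρ₃ σ₃) (est ρ₃ σ₄) 3 := by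
    have h := runs_setTop_cons oWd (est ρ₃ σ₃) (b := b) (rest := rest') (by simp [hσ₃, hdrop])
    refine h.of_eq ?_ le_rfl
    simp only [hσ₄, hσ₃]; simp
  set σ₅ : YRF := { σ₄ with Wd := σ.Wd.set i true, P := [] } with hσ₅
  have h5 : Runs (pour oP oWd) (est ρ₃ σ₄) (est ρ₃ σ₅) (3 * i + 1) := by
    have h := runs_pour (a := oP) (b := oWd) (by decide) (est ρ₃ σ₄)
    have hlen : (est ρ₃ σ₄ oP).length = i := by simp [hσ₄, hσ₃, List.length_take]; omega
    rw [hlen] at h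
    refine h.of_eq ?_ le_rfl
    simp only [hσ₅, hσ₄, hσ₃, hσ₂, hσ₁]
    simp [List.set_eq_take_append_cons_drop, hWd, hi, hrest']
  have h6 : Runs (clear iV) (est ρ₃ σ₅) (est ρ σ₅) (2 * i + 1) := by
    have h := runs_clear iV (est ρ₃ σ₅)
    have hlen : (est ρ₃ σ₅ iV).length = i := by simp [hρ₃]
    rw [hlen] at h
    refine h.of_eq ?_ le_rfl
    simp only [hρ₃]; simp [← hV]
  have H := h1.seq (h2.seq (h3.seq (h4.seq (h5.seq h6))))
  refine H.of_eq ?_ ?_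
  · simp only [hσ₅, hσ₄, hσ₃, hσ₂, hσ₁, hIc, hP]
  · have hl := length_encodeNat_le_self i
    have h7 : (encodeNat i).length * (7 * i + 5) ≤ n * (7 * n + 5) :=
      Nat.mul_le_mul (by omega) (by omega)
    have h8 : n * (7 * n + 5) = 7 * n * n + 5 * n := by ring
    unfold idxBound; omega

/-- The loop over the variables of a term. [folklore] -/
theorem runs_idxLoop {n : ℕ} : ∀ (L : List ℕ) (rest : List (List Bool)) (ρ : RRF) (σ : YRF),
    σ.inp = encList (L.map encodeNat ++ rest) → ρ.A = [] → ρ.w = [] → ρ.V = [] → σ.Ic = [] →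
    σ.N2 = [] → σ.P = [] → σ.Wd.length = n → σ.Cc = List.replicate L.length true → (∀ i ∈ L, i < n) →
    Runs (countLoop oCc idxBody) (est ρ σ) (est ρ { σ with
      inp := encList rest, Cc := [], Wd := L.foldl (fun w i => w.set i true) σ.Wd })
      (L.length * (idxBound n + 2) + 1)
  | [], rest, ρ, σ, hinp, hA, hw, hV, hIc, hN2, hP, hWd, hCc, hL => by
    refine (Runs.loop_nil _ _ (by simpa using hCc)).of_eq ?_ (by simp)
    obtain ⟨⟩ := σ; simp only at hinp hCc ⊢; simp [hinp, hCc]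
  | i :: L, rest, ρ, σ, hinp, hA, hw, hV, hIc, hN2, hP, hWd, hCc, hL => by
    have hk : est ρ σ oCc = true :: List.replicate L.length true := by simp [hCc, List.replicate_succ]
    set σ₀ : YRF := { σ with Cc := List.replicate L.length true } with hσ₀
    have hb := runs_idxBody (n := n) i (encList (L.map encodeNat ++ rest)) ρ σ₀
      (by simp [hσ₀, hinp, encList_cons_eq_dbl]) hA hw hV (by simp [hσ₀, hIc]) (by simp [hσ₀, hN2])
      (by simp [hσ₀, hP]) (by simp [hσ₀, hWd]) (hL i (by simp))
    set σ₁ : YRF := { σ₀ with inp := encList (L.map encodeNat ++ rest), Wd := σ.Wd.set i true } with hσ₁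
    have ih := runs_idxLoop L rest ρ σ₁ (by simp [hσ₁]) hA hw hV (by simp [hσ₁, hσ₀, hIc])
      (by simp [hσ₁, hσ₀, hN2]) (by simp [hσ₁, hσ₀, hP]) (by simp [hσ₁, hWd]) (by simp [hσ₁, hσ₀])
      (fun j hj => hL j (by simp [hj]))
    refine (Runs.loop_true hk (by simpa [hσ₀] using hb) ih).of_eq ?_ ?_
    · simp only [hσ₁, hσ₀, List.foldl_cons]
    · simp only [List.length_cons]; ring_nf; omega

/-- The items of one term: its cardinality, then its variables in increasing order. [folklore] -/
def termItems {n : ℕ} (t : Finset (Fin n)) : List (List Bool) :=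
  encodeNat t.card :: ((t.sort (· ≤ ·)).map Fin.val).map encodeNat

/-- The items of the value table of the symmetric gate on `0, …, s`. [folklore] -/
def tableItems {n : ℕ} (S : SymPlus n) : List (List Bool) :=
  (List.range (S.size + 1)).map fun v => encodeNat (if S.sym v then 1 else 0)

/-- The body items are the term items followed by the table items. [folklore] -/
theorem bodyItems_eq {n : ℕ} (S : SymPlus n) :
    bodyItems S = S.terms.flatMap termItems ++ tableItems S := by
  simp only [bodyItems, List.map_append, List.map_flatMap, tableItems, List.map_cons, List.map_map]
  congr 1
  refine List.flatMap_congr fun t _ => ?_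
  simp [termItems, List.map_map]

/-- The body for one term: read its cardinality `c` in unary, start from the all-zero word,
set the bits of its `c` variables, tag the word with a leading `0` and emit it onto `M`.
[folklore] -/
def termBody : Com YReg :=
  readItem oInp iA iw ;; binToUnary iA oCc oN2 ;; (fillFalse oWd oN oN2 ;; pour oN2 oN) ;;
    countLoop oCc idxBody ;; (push oWd false ;; emit oWd oM)

/-- A uniform bound for the cost of `termBody`. [folklore] -/
def termBound (n : ℕ) : ℕ :=
  8 * n + 8 + (n * (7 * n + 5) + 1) + (4 * n + 1 + (3 * n + 1)) + (n * (idxBound n + 2) + 1) +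
    (1 + (4 * (n + 1) + 3))

/-- **Effect of `termBody`** on the next term `t`: its tagged mask word `0 :: maskWord t` is
emitted onto `M`. [folklore] -/
theorem runs_termBody {n : ℕ} (t : Finset (Fin n)) (rest : List (List Bool)) (ρ : RRF) (σ : YRF)
    (hinp : σ.inp = encList (termItems t ++ rest)) (hA : ρ.A = []) (hw : ρ.w = []) (hV : ρ.V = [])
    (hIc : σ.Ic = []) (hN2 : σ.N2 = []) (hP : σ.P = []) (hWd : σ.Wd = []) (hCc : σ.Cc = [])
    (hN : σ.N = List.replicate n true) :
    Runs termBody (est ρ σ) (est ρ { σ with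
      inp := encList rest, M := true :: false :: (dbl (false :: maskWord t)).reverse ++ σ.M })
      (termBound n) := by
  have hcard : t.card ≤ n := (Finset.card_le_univ t).trans (by simp)
  set L := (t.sort (· ≤ ·)).map Fin.val with hLdef
  have hLlen : L.length = t.card := by simp [hLdef]
  have hLlt : ∀ i ∈ L, i < n := by
    intro i hi; simp only [hLdef, List.mem_map] at hi; obtain ⟨j, -, rfl⟩ := hi; exact j.2
  -- read the cardinality
  set σ₁ : YRF := { σ with inp := encList (L.map encodeNat ++ rest) } with hσ₁
  set ρ₁ : RRF := { ρ with A := (encodeNat t.card).reverse } with hρ₁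
  have h1 : Runs (readItem oInp iA iw) (est ρ σ) (est ρ₁ σ₁) (8 * (encodeNat t.card).length + 8) := by
    have h := runs_readItem (L := oInp) (A := iA) (w := iw) (by decide) (by decide) (by decide)
      (encodeNat t.card) (encList (L.map encodeNat ++ rest)) (est ρ σ)
      (by simp [hinp, termItems, hLdef, encList_cons_eq_dbl]) (by simp [hw])
    refine h.of_eq ?_ le_rfl
    simp only [hσ₁, hρ₁]; simp [hA]
  set σ₂ : YRF := { σ₁ with Cc := List.replicate t.card true } with hσ₂
  have h2 : Runs (binToUnary iA oCc oN2) (est ρ₁ σ₁) (est ρ σ₂)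
      ((encodeNat t.card).length * (7 * t.card + 5) + 1) := by
    have h := runs_binToUnary (A := iA) (N := oCc) (N2 := oN2) (by decide) (by decide) (by decide)
      ((encodeNat t.card).reverse) 0 (est ρ₁ σ₁) (by simp [hρ₁]) (by simp [hσ₁, hCc]) (by simp [hσ₁, hN2])
    simp only [List.length_reverse, zero_mul, zero_add, msbVal_reverse_encodeNat] at h
    refine h.of_eq ?_ le_rfl
    simp only [hσ₂, hσ₁, hρ₁]; simp [← hA]
  -- the all-zero word
  set σ₃ : YRF := { σ₂ with Wd := List.replicate n false, N := [], N2 := List.replicate n true } with hσ₃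
  have h3 : Runs (fillFalse oWd oN oN2) (est ρ σ₂) (est ρ σ₃) (4 * n + 1) := by
    have h := runs_fillFalse (A := oWd) (U := oN) (V := oN2) (by decide) (by decide) (by decide) n
      (est ρ σ₂) (by simp [hσ₂, hσ₁, hN])
    refine h.of_eq ?_ le_rfl
    simp only [hσ₃, hσ₂, hσ₁]; simp [hWd, hN2]
  set σ₄ : YRF := { σ₃ with N := List.replicate n true, N2 := [] } with hσ₄
  have h4 : Runs (pour oN2 oN) (est ρ σ₃) (est ρ σ₄) (3 * n + 1) := by
    have h := runs_pour (a := oN2) (b := oN) (by decide) (est ρ σ₃)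
    have hlen : (est ρ σ₃ oN2).length = n := by simp [hσ₃]
    rw [hlen] at h
    refine h.of_eq ?_ le_rfl
    simp only [hσ₄, hσ₃]; simp
  -- the variables
  set σ₅ : YRF := { σ₄ with inp := encList rest, Cc := [], Wd := maskWord t } with hσ₅
  have h5 : Runs (countLoop oCc idxBody) (est ρ σ₄) (est ρ σ₅) (L.length * (idxBound n + 2) + 1) := by
    have h := runs_idxLoop (n := n) L rest ρ σ₄ (by simp [hσ₄, hσ₃, hσ₂, hσ₁]) hA hw hV
      (by simp [hσ₄, hσ₃, hσ₂, hσ₁, hIc]) (by simp [hσ₄]) (by simp [hσ₄, hσ₃, hσ₂, hσ₁, hP])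
      (by simp [hσ₄, hσ₃]) (by simp [hσ₄, hσ₃, hσ₂, hLlen]) hLlt
    refine h.of_eq ?_ le_rfl
    simp only [hσ₅, hσ₄, hσ₃, hσ₂, hσ₁]
    rw [show List.foldl (fun w i => w.set i true) (List.replicate n false) L = maskWord t from
      foldl_set_eq_maskWord t]
  -- tag and emit
  set σ₆ : YRF := { σ₅ with Wd := false :: maskWord t } with hσ₆
  have h6 : Runs (push oWd false) (est ρ σ₅) (est ρ σ₆) 1 := Runs.push' (by simp only [hσ₆, hσ₅]; simp)
  set σ₇ : YRF := { σ₆ with Wd := [], M := true :: false :: (dbl (false :: maskWord t)).reverse ++ σ.M }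
    with hσ₇
  have h7 : Runs (emit oWd oM) (est ρ σ₆) (est ρ σ₇) (4 * (n + 1) + 3) := by
    have h := runs_emit (h := oWd) (o := oM) (by decide) (est ρ σ₆)
    have hlen : (est ρ σ₆ oWd).length = n + 1 := by simp [hσ₆, maskWord]
    rw [hlen] at h
    refine h.of_eq ?_ le_rfl
    simp only [hσ₇, hσ₆, hσ₅, hσ₄, hσ₃, hσ₂, hσ₁]; simp [dbl]
  have H := h1.seq (h2.seq ((h3.seq h4).seq (h5.seq (h6.seq h7))))
  refine H.of_eq ?_ ?_
  · simp only [hσ₇, hσ₆, hσ₅, hσ₄, hσ₃, hσ₂, hσ₁, hIc, hP, hWd, hCc, hN, hN2]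
  · have hl := length_encodeNat_le_self t.card
    have e1 : (encodeNat t.card).length * (7 * t.card + 5) ≤ n * (7 * n + 5) :=
      Nat.mul_le_mul (by omega) (by omega)
    have e2 : L.length * (idxBound n + 2) ≤ n * (idxBound n + 2) := Nat.mul_le_mul_right _ (by omega)
    unfold termBound; omega

/-- `masksProg`: one `termBody` per token of the term counter `Sc`. [folklore] -/
def masksProg : Com YReg := countLoop oSc termBody

/-- **Effect of the mask phase**: the tagged mask words of the terms are emitted onto `M` in
order (as a reversed code, `outRev`), the term items are consumed. [folklore] -/
theorem runs_masksProg {n : ℕ} : ∀ (T : List (Finset (Fin n))) (E rest : List (List Bool)) (ρ : RRF)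
    (σ : YRF), σ.inp = encList (T.flatMap termItems ++ rest) → ρ.A = [] → ρ.w = [] → ρ.V = [] →
    σ.Ic = [] → σ.N2 = [] → σ.P = [] → σ.Wd = [] → σ.Cc = [] → σ.N = List.replicate n true →
    σ.M = outRev E → σ.Sc = List.replicate T.length true →
    Runs masksProg (est ρ σ) (est ρ { σ with
      inp := encList rest, Sc := [], M := outRev (E ++ T.map fun t => false :: maskWord t) })
      (T.length * (termBound n + 2) + 1)
  | [], E, rest, ρ, σ, hinp, hA, hw, hV, hIc, hN2, hP, hWd, hCc, hN, hM, hSc => by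
    refine (Runs.loop_nil _ _ (by simpa using hSc)).of_eq ?_ (by simp)
    obtain ⟨⟩ := σ; simp only at hinp hSc hM ⊢; simp [hinp, hSc, hM]
  | t :: T, E, rest, ρ, σ, hinp, hA, hw, hV, hIc, hN2, hP, hWd, hCc, hN, hM, hSc => by
    have hk : est ρ σ oSc = true :: List.replicate T.length true := by simp [hSc, List.replicate_succ]
    set σ₀ : YRF := { σ with Sc := List.replicate T.length true } with hσ₀
    have hb := runs_termBody t (T.flatMap termItems ++ rest) ρ σ₀
      (by simp [hσ₀, hinp, List.flatMap_cons, List.append_assoc]) hA hw hV (by simp [hσ₀, hIc])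
      (by simp [hσ₀, hN2]) (by simp [hσ₀, hP]) (by simp [hσ₀, hWd]) (by simp [hσ₀, hCc]) (by simp [hσ₀, hN])
    set σ₁ : YRF := { σ₀ with
      inp := encList (T.flatMap termItems ++ rest)
      M := true :: false :: (dbl (false :: maskWord t)).reverse ++ σ.M } with hσ₁
    have ih := runs_masksProg T (E ++ [false :: maskWord t]) rest ρ σ₁ (by simp [hσ₁]) hA hw hV
      (by simp [hσ₁, hσ₀, hIc]) (by simp [hσ₁, hσ₀, hN2]) (by simp [hσ₁, hσ₀, hP]) (by simp [hσ₁, hσ₀, hWd])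
      (by simp [hσ₁, hσ₀, hCc]) (by simp [hσ₁, hσ₀, hN]) (by simp [hσ₁, hM, outRev_append, dbl])
      (by simp [hσ₁, hσ₀])
    refine (Runs.loop_true hk (by simpa [hσ₀] using hb) ih).of_eq ?_ ?_
    · simp only [hσ₁, hσ₀, List.map_cons, List.append_assoc, List.singleton_append]
    · simp only [List.length_cons]; ring_nf; omega

end YatesM

end Literature.Computability.Complexity
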